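import Summits.Ventures.AbcSig.Sieve.Certificate

/-!
# Venture AbcSig — prime-ideal sieve trees with MOD-`n` Bézout leaves (one exponent at a time)

HONEST FRAMING. Certificate checker of a COMPUTATION cell (`pub-abcsig`); no Diophantine statement, no claim on ABC or any
summit. `Sieve/Certificate.lean` closes a branch of a sieve tree with an INTEGER witness `Σ uⱼ·gⱼ = r` over `ℤ[x]` and then
needs `n ∤ r`; for one fixed exponent `n` it is enough — and much cheaper, the cofactors live in `(ℤ/n)[x]` — to certify
`Σ uⱼ·gⱼ ≡ 1 (mod n)`: a ring homomorphism `φ : ℤ[X] → k` into a field of characteristic `n` killing the branch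
generators `gⱼ` would send the left side to `0` and the right side to `1`. THIS FILE: `bezoutCheckModN`, the tree type
`TreeN` (same `split` nodes as `Tree`, branching on the allowed traces of one listed entry; leaves carry mod-`n`
cofactors), the kernel-evaluable `TreeN.check`, its soundness, and `OrbitData.eliminated_of_checkN :
T.check n fuel o A [o.F] = true → o.Eliminated A n`. Used by the norm-form level files (p-lean g4) for the (orbit, n)
pairs where the norm form of [BS04, Prop. 4.3] is weaker than the prime-ideal sieve; no primality of `n`, no size bound
on the Hecke field degree (the witnesses are reduced mod `n`).

Reference: [BS04] Bennett–Skinner, Canad. J. Math. 56 (2004), Prop. 4.3 (congruences `c_ℓ ≡ t` modulo a prime above `n`).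
-/

namespace Summit.Ventures.AbcSig

open Polynomial

/-! ## Bézout witnesses modulo `n` -/

/-- Every coefficient of the list is divisible by `n`. -/
def isZeroModL (n : ℕ) (p : List ℤ) : Bool := p.all fun a => a % (n : ℤ) == 0

/-- A coefficient list all of whose entries are divisible by `n` maps to `0` under any ring homomorphism
`ℤ[X] → R` into a ring of characteristic `n`. -/
lemma map_toPoly_eq_zero_of_isZeroModL (n : ℕ) {R : Type*} [CommRing R] [CharP R n] (φ : ℤ[X] →+* R) :
    ∀ p : List ℤ, isZeroModL n p = true → φ (toPoly p) = 0
  | [], _ => by simp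
  | a :: p, h => by
      simp only [isZeroModL, List.all_cons, Bool.and_eq_true, beq_iff_eq] at h
      have ha : (a : R) = 0 := by
        rw [CharP.intCast_eq_zero_iff R n]
        exact Int.dvd_of_emod_eq_zero h.1
      have hp := map_toPoly_eq_zero_of_isZeroModL n φ p (by simpa [isZeroModL] using h.2)
      have hC : φ (C a) = (a : R) := by
        rw [show (C a : ℤ[X]) = (a : ℤ[X]) from Polynomial.C_eq_intCast a, map_intCast]
      rw [toPoly_cons, map_add, map_mul, hp, hC, ha, mul_zero, add_zero]

/-- **Mod-`n` Bézout check** (computable): `Σ us[i]·Ps[i] − 1` has all coefficients divisible by `n`. -/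
def bezoutCheckModN (n : ℕ) (Ps us : List (List ℤ)) : Bool :=
  isZeroModL n (addL (linComb us Ps) [-1])

/-- **Elimination in characteristic `n`, mod-`n` witness.** If `bezoutCheckModN n Ps us` holds there is no ring
homomorphism `ℤ[X] → k` into a field of characteristic `n` killing all of `Ps`. -/
theorem bezoutModN_elim {n : ℕ} {Ps us : List (List ℤ)} (h : bezoutCheckModN n Ps us = true)
    {k : Type} [Field k] [CharP k n] (φ : ℤ[X] →+* k) (hP : ∀ P ∈ Ps, φ (toPoly P) = 0) : False := by
  have h0 := map_toPoly_eq_zero_of_isZeroModL n φ _ h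
  rw [toPoly_addL, map_add, map_toPoly_linComb_eq_zero φ us Ps hP, toPoly_singleton, C_neg, map_neg, zero_add,
    neg_eq_zero] at h0
  simp at h0

/-! ## Trees with mod-`n` leaves -/

/-- A sieve decision tree for ONE exponent `n`: `leaf us` closes the branch with mod-`n` Bézout cofactors for the
current generator list; `split i kids` branches on the value `t` of entry `i` of the orbit data (one child per
allowed trace). -/
inductive TreeN where
  /-- close the branch: `Σ us[j] · gens[j] ≡ 1 (mod n)` -/
  | leaf (us : List (List ℤ)) : TreeN
  /-- branch on entry `i`: one subtree per candidate trace `t` -/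
  | split (i : ℕ) (kids : List (ℤ × TreeN)) : TreeN

/-- **The checker.** `T.check n fuel o A gens`: every leaf's mod-`n` Bézout identity holds for the generators accumulated
on its branch (initially `[o.F]`), every split is on a listed entry at a prime `ℓ ≠ n` and has a child for each
`t ∈ A ℓ` (extra children are checked too, harmlessly). Structural recursion on `fuel`, so `decide` evaluates it. -/
def TreeN.check (n : ℕ) : ℕ → TreeN → OrbitData → (ℕ → List ℤ) → List (List ℤ) → Bool
  | 0, _, _, _, _ => false
  | _ + 1, .leaf us, _, _, gens => bezoutCheckModN n gens us
  | fuel + 1, .split i kids, o, A, gens =>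
      match o.coeffs[i]? with
      | none => false
      | some e =>
          decide (e.ell ≠ n) && (A e.ell).all (fun t => kids.any (fun kt => kt.1 == t)) &&
            kids.all (fun kt => TreeN.check n fuel kt.2 o A (gens ++ [e.gen kt.1]))

/-- **Soundness of the checker.** If `T.check n fuel o A gens = true` then no ring homomorphism `φ : ℤ[X] → k` into a
field of characteristic `n` kills `gens` while realising allowed traces at every listed prime `ℓ ≠ n`. Proof: induction
on `fuel`; a leaf is `bezoutModN_elim`; at a split on entry `e` (with `ℓ_e ≠ n` checked), `φ(g_e) = d_e t` for some
allowed `t`, the child for `t` exists and passes the check with the extra generator `g_e − d_e t`, which `φ` kills. -/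
theorem TreeN.check_sound (n : ℕ) : ∀ (fuel : ℕ) (T : TreeN) (o : OrbitData) (A : ℕ → List ℤ)
    (gens : List (List ℤ)), T.check n fuel o A gens = true →
    ∀ (k : Type) [Field k] [CharP k n] (φ : ℤ[X] →+* k), (∀ P ∈ gens, φ (toPoly P) = 0) →
    (∀ e ∈ o.coeffs, e.ell ≠ n → ∃ t ∈ A e.ell, φ (toPoly e.g) = (e.d : k) * (t : k)) → False
  | 0, T, o, A, gens, h, k, _, _, φ, hg, hA => by
      cases T <;> simp [TreeN.check] at h
  | fuel + 1, .leaf us, o, A, gens, h, k, _, _, φ, hg, hA => by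
      simp only [TreeN.check] at h
      exact bezoutModN_elim h φ hg
  | fuel + 1, .split i kids, o, A, gens, h, k, _, _, φ, hg, hA => by
      simp only [TreeN.check] at h
      split at h
      · simp at h
      · rename_i e he
        simp only [Bool.and_eq_true, decide_eq_true_eq] at h
        obtain ⟨⟨hne, hcov⟩, hkids⟩ := h
        have he_mem : e ∈ o.coeffs := List.mem_of_getElem? he
        obtain ⟨t, ht, hφ⟩ := hA e he_mem hne
        obtain ⟨kt, hkt, hkt1⟩ := List.any_eq_true.mp (List.all_eq_true.mp hcov t ht)
        have hkt1' : kt.1 = t := by simpa using hkt1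
        have hchild := List.all_eq_true.mp hkids kt hkt
        refine TreeN.check_sound n fuel kt.2 o A (gens ++ [e.gen kt.1]) hchild k φ ?_ hA
        intro P hP
        rcases List.mem_append.mp hP with hP | hP
        · exact hg P hP
        · rw [List.mem_singleton] at hP
          subst hP
          rw [hkt1']
          exact e.map_gen_eq_zero t φ hφ

/-- A checked mod-`n` tree (run from the generator list `[F]`) eliminates the exponent `n` for the orbit data. -/
theorem OrbitData.eliminated_of_checkN (o : OrbitData) (A : ℕ → List ℤ) (T : TreeN) (n fuel : ℕ)
    (h : T.check n fuel o A [o.F] = true) : o.Eliminated A n := by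
  intro k _ _ φ hφ
  exact TreeN.check_sound n fuel T o A [o.F] h k φ (by simpa using hφ.1) hφ.2

/-! ## Toy certificate (kernel-evaluated): `F = x² − 2`, entry `c₃ = θ`, TOY allowed traces `{0, 2}`, exponent `n = 7`:
on the branch `t = 0`: `4·(x² − 2) + (−4x)·(x − 0) = −8 ≡ −1`, i.e. `(−4)(x²−2) + 4x·x = 8 ≡ 1 (mod 7)`;
on `t = 2`: `(−4)(x² − 2) + (4x + 8)(x − 2) = … `; we let the kernel find nothing — the witnesses below were computed by hand:
`t = 0`: `us = [[-4], [0, 4]]` (`−4(x²−2) + 4x·x = 8`); `t = 2`: `us = [[-4], [8, 4]]` (`−4(x²−2) + (4x+8)(x−2) = 8 − 16 = −8`),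
and `−8 ≡ −1`, so for `t = 2` use `us = [[4], [-8, -4]]` (`= 8 ≡ 1`). -/

/-- Toy tree for the exponent `7`. -/
def toyTreeN : TreeN := .split 0 [(0, .leaf [[-4], [0, 4]]), (2, .leaf [[4], [-8, -4]])]

/-- The toy tree passes the mod-7 check against `toyOrbit` / `toyAllowed` of `Sieve/Certificate.lean`. -/
example : toyTreeN.check 7 3 toyOrbit toyAllowed [toyOrbit.F] = true := by decide

/-- Hence the toy orbit data is eliminated for the exponent `7` (mod-`n` route). -/
example : toyOrbit.Eliminated toyAllowed 7 := toyOrbit.eliminated_of_checkN toyAllowed toyTreeN 7 3 (by decide)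

end Summit.Ventures.AbcSig
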